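import Summits.PneNP.PneNP.Theorems.ConvexRankGatesConvexGateBlindXorDefs
import Summits.PneNP.PneNP.Theorems.ConvexRankGatesConvexGateBlindRankForm

/-!
# `ExactLifting` holds against ONE-SIDED junta factorisations (any size, any shift, any `t ≥ 2`)

Support file for crux `ConvexGateBlind` (stmt-PneNP-10680), line `xor-door-perfect-completeness`, open stub
`stub_exactLifting` (lead c1, cycle 1).

`ExactLifting` asks that every cone factorisation of the shifted Index-lift `viol_F(x[w]) - ε` of a
perfectly fooled system `F` be large. The landed fragment `no_blockJunta_shift_of`
(`…ExactLiftingBlockJunta.lean`) kills terms that are block-juntas JOINTLY in `(x, w)`. This file kills a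
much larger class, with the same ten-line mechanism plus one new ingredient:

* **The XOR core of the Index-lift** (`exists_xorCore`). For `t ≥ 2` the string table
  `X z` (block `i` = `(z i, z i + 1, z i, …, z i)`) and the pointer `W y` (block `i` points at position `1`
  if `y i = 1`, else at `0`) satisfy `(X z)[W y] = z + y`: the `2^m × 2^m` XOR-shift matrix
  `[viol_F(z + y)]_{z,y}` is a submatrix of the Index-lift.
* **No one-sided junta decomposition of a positive shift** (`no_oneSidedJunta_shift_of`). If
  `viol_F(x[w]) - ε = ∑_l T_l(x, w)` with NON-NEGATIVE terms `T_l`, each of which is EITHER a block-junta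
  in `x` for every fixed `w` OR a block-junta in `w` for every fixed `x` (block degree `≤ d`, the side may
  depend on `l`), then `F` has no degree-`d` perfect-completeness pseudo-expectation. Proof: restrict to the
  XOR core, substitute `y := z + y'` and sum over `z`; every term becomes a non-negative `d`-junta of `y'`
  (a sum of shifts of juntas), while the left side becomes `2^m (viol_F(y') - ε)`; apply `Ẽ`.
* Corollaries for rank-one terms `u_l(x) v_l(w)`: `no_rowJunta_shift_of` (all row factors block-juntas,
  column factors ARBITRARY), `no_colJunta_shift_of` (all column factors block-juntas, row factors
  ARBITRARY), `no_mixedJunta_shift_of` (each term junta on a side of its choice), and for cone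
  factorisations `no_colJunta_coneFact_of` (PSD part `tr(H_x Y_w)` with `Y` a block-junta of `w`, LP
  column factors block-juntas; `H`, `U` arbitrary).

Consequence for the stub: in any cone factorisation of `viol_F(x[w]) - ε` (which `ExactLifting` says must
have `q + r ≥ t^{φ(d)}`), restricted to the XOR core, it is impossible that every term has a junta side;
the junta-approximation step of GLMWZ 2016 / KMR 2017 must fail EXACTLY on both sides of some term. All
statements are `ε`-uniform and size-free.
-/

set_option linter.dupNamespace false -- `Summit.PneNP.PneNP.…`: summit = sub-problem (D-0017)

namespace Summit.PneNP.PneNP.Theorems.XorDoor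

open scoped BigOperators
open Finset Matrix

noncomputable section

/-! ## §1 The XOR core of the Index-lift -/

/-- **The Index-lift contains the XOR-shift matrix** (`t ≥ 2`). There are string tables `X z` and
pointers `W y` (`z, y : 𝔽₂^m`) with `(X z)[W y] = z + y`, where block `i` of `X z` depends only on `z i`
and block `i` of `W y` only on `y i`. (Table: block `i` holds `z i + 1` at position `1` and `z i`
elsewhere; pointer: position `1` if `y i = 1`, else position `0`.) -/
theorem exists_xorCore {t : ℕ} (ht : 2 ≤ t) (m : ℕ) :
    ∃ (X : (Fin m → ZMod 2) → (Fin m → Fin t → ZMod 2)) (W : (Fin m → ZMod 2) → (Fin m → Fin t)),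
      (∀ z y : Fin m → ZMod 2, (fun i => X z i (W y i)) = z + y) ∧
      (∀ (z z' : Fin m → ZMod 2) (i : Fin m), z i = z' i → X z i = X z' i) ∧
      (∀ (y y' : Fin m → ZMod 2) (i : Fin m), y i = y' i → W y i = W y' i) := by
  have h01 : ∀ a : ZMod 2, a = 0 ∨ a = 1 := by decide
  refine ⟨fun z i j => if (j : ℕ) = 1 then z i + 1 else z i,
    fun y i => if y i = 1 then ⟨1, ht⟩ else ⟨0, lt_of_lt_of_le Nat.zero_lt_two ht⟩,
    fun z y => ?_, fun z z' i h => ?_, fun y y' i h => ?_⟩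
  · funext i
    rw [Pi.add_apply]
    rcases h01 (y i) with hy | hy
    · simp [hy]
    · simp [hy]
  · funext j
    simp only [h]
  · simp only [h]

/-! ## §2 No one-sided junta decomposition of a positive shift -/

/-- **No one-sided junta decomposition of a positive shift of the lift.** Let `F` carry a degree-`d`
perfect-completeness pseudo-expectation, `t ≥ 2`, `ε > 0`. Then there is no identity
`viol_F(x[w]) - ε = ∑_l T_l(x, w)` with finitely many NON-NEGATIVE terms `T_l` such that each `T_l` is
either a block-junta in `x` for every fixed `w` (it depends only on the blocks `x i`, `i ∈ S l`) or a
block-junta in `w` for every fixed `x` (only on `w i`, `i ∈ S l`), where `#(S l) ≤ d` — regardless of the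
number of terms and of which side each term chooses. -/
theorem no_oneSidedJunta_shift_of {m d t : ℕ} {F : Finset (Pool m)} (hE : HasPerfectPseudoExp d F)
    (ht : 2 ≤ t) {ε : ℝ} (hε : 0 < ε) {L : Type} [Fintype L] (S : L → Finset (Fin m))
    (hS : ∀ l, (S l).card ≤ d)
    (T : L → (Fin m → Fin t → ZMod 2) → (Fin m → Fin t) → ℝ)
    (hT0 : ∀ l x w, 0 ≤ T l x w)
    (hT : ∀ l, (∀ (w : Fin m → Fin t) (x x' : Fin m → Fin t → ZMod 2),
                  (∀ i ∈ S l, x i = x' i) → T l x w = T l x' w) ∨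
               (∀ (x : Fin m → Fin t → ZMod 2) (w w' : Fin m → Fin t),
                  (∀ i ∈ S l, w i = w' i) → T l x w = T l x w')) :
    ¬ ∀ (x : Fin m → Fin t → ZMod 2) (w : Fin m → Fin t),
        (viol F (fun i => x i (w i)) : ℝ) - ε = ∑ l, T l x w := by
  classical
  intro hfact
  obtain ⟨E, hSA, -, hone, hviol⟩ := hE
  -- the XOR core: tables `X z`, pointers `W y`, `(X z)[W y] = z + y`
  obtain ⟨X, W, hread, hXc, hWc⟩ := exists_xorCore ht m
  -- characteristic two: `z + (z + y) = y`, `z + y + y = z`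
  have hccl : ∀ z y : Fin m → ZMod 2, z + (z + y) = y := fun z y => by
    funext i
    simp only [Pi.add_apply]
    rw [← add_assoc, CharTwo.add_self_eq_zero, zero_add]
  have hccr : ∀ z y : Fin m → ZMod 2, z + y + y = z := fun z y => by
    funext i
    simp only [Pi.add_apply]
    rw [add_assoc, CharTwo.add_self_eq_zero, add_zero]
  -- the convolved terms `c l y' = ∑_z T l (X z) (W (z + y'))`
  let c : L → (Fin m → ZMod 2) → ℝ := fun l y' => ∑ z : Fin m → ZMod 2, T l (X z) (W (z + y'))
  have hc0 : ∀ l y', 0 ≤ c l y' := fun l y' => Finset.sum_nonneg fun z _ => hT0 l _ _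
  -- the identity on the XOR core, summed over `z`
  have hid : ∀ y' : Fin m → ZMod 2,
      (Fintype.card (Fin m → ZMod 2) : ℝ) * ((viol F y' : ℝ) - ε) = ∑ l, c l y' := by
    intro y'
    have hz : ∀ z : Fin m → ZMod 2, (viol F y' : ℝ) - ε = ∑ l, T l (X z) (W (z + y')) := by
      intro z
      have h := hfact (X z) (W (z + y'))
      rwa [show (fun i => X z i (W (z + y') i)) = y' from by
        rw [hread z (z + y'), hccl]] at h
    calc (Fintype.card (Fin m → ZMod 2) : ℝ) * ((viol F y' : ℝ) - ε)
        = ∑ _z : Fin m → ZMod 2, ((viol F y' : ℝ) - ε) := by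
          rw [Finset.sum_const, Finset.card_univ, nsmul_eq_mul]
      _ = ∑ z : Fin m → ZMod 2, ∑ l, T l (X z) (W (z + y')) := Finset.sum_congr rfl fun z _ => hz z
      _ = ∑ l, c l y' := Finset.sum_comm
  -- every `c l` is a `d`-junta
  have hcj : ∀ l, IsJunta d (c l) := by
    intro l
    refine ⟨S l, hS l, fun y y' hyy' => ?_⟩
    rcases hT l with hrow | hcol
    · -- row-junta terms: reindex `z ↦ z + y` first
      have hre : ∀ u : Fin m → ZMod 2,
          c l u = ∑ z : Fin m → ZMod 2, T l (X (z + u)) (W z) := by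
        intro u
        show ∑ z : Fin m → ZMod 2, T l (X z) (W (z + u)) = _
        rw [← Equiv.sum_comp (Equiv.addRight u) (fun z => T l (X z) (W (z + u)))]
        refine Finset.sum_congr rfl fun z _ => ?_
        simp only [Equiv.coe_addRight]
        rw [hccr]
      rw [hre y, hre y']
      refine Finset.sum_congr rfl fun z _ => hrow (W z) _ _ fun i hi => ?_
      exact hXc _ _ i (by simp only [Pi.add_apply, hyy' i hi])
    · -- column-junta terms: termwise
      refine Finset.sum_congr rfl fun z _ => hcol (X z) _ _ fun i hi => ?_
      exact hWc _ _ i (by simp only [Pi.add_apply, hyy' i hi])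
  -- apply the pseudo-expectation to the function identity
  have hfun : (Fintype.card (Fin m → ZMod 2) : ℝ) • ((fun y => (viol F y : ℝ)) - ε • fun _ => (1 : ℝ))
      = ∑ l, c l := by
    funext y'
    simp only [Pi.smul_apply, Pi.sub_apply, Finset.sum_apply, smul_eq_mul, mul_one]
    exact hid y'
  have hlhs : E ((Fintype.card (Fin m → ZMod 2) : ℝ) • ((fun y => (viol F y : ℝ)) - ε • fun _ => (1 : ℝ)))
      = -((Fintype.card (Fin m → ZMod 2) : ℝ) * ε) := by
    rw [map_smul, map_sub, map_smul, hviol, hone, smul_eq_mul, smul_eq_mul, mul_one, zero_sub, mul_neg]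
  have hrhs : 0 ≤ E (∑ l, c l) := by
    rw [map_sum]
    exact Finset.sum_nonneg fun l _ => hSA (c l) (hcj l) (hc0 l)
  have hcard : (0 : ℝ) < Fintype.card (Fin m → ZMod 2) := by exact_mod_cast Fintype.card_pos
  rw [← hfun, hlhs] at hrhs
  nlinarith

/-- **No one-sided junta decomposition of a positive shift of the lift** — registered sub-goal
`no_oneSidedJunta_shift` of stmt-PneNP-10680, verbatim signature (see `no_oneSidedJunta_shift_of`). -/
theorem no_oneSidedJunta_shift :
    ∀ {m d t : ℕ} {F : Finset (Pool m)}, HasPerfectPseudoExp d F → 2 ≤ t → ∀ {ε : ℝ}, 0 < ε → ∀ {L :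
    Type} [Fintype L] (S : L → Finset (Fin m)), (∀ l, (S l).card ≤ d) → ∀ (T : L → (Fin m → Fin t → ZMod
    2) → (Fin m → Fin t) → ℝ), (∀ l x w, 0 ≤ T l x w) → (∀ l, (∀ (w : Fin m → Fin t) (x x' : Fin m → Fin
    t → ZMod 2), (∀ i ∈ S l, x i = x' i) → T l x w = T l x' w) ∨ (∀ (x : Fin m → Fin t → ZMod 2) (w w' :
    Fin m → Fin t), (∀ i ∈ S l, w i = w' i) → T l x w = T l x w')) → ¬ ∀ (x : Fin m → Fin t → ZMod 2) (w
    : Fin m → Fin t), (viol F (fun i => x i (w i)) : ℝ) - ε = ∑ l, T l x w :=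
  fun hE ht _ hε _ _ S hS T hT0 hT => no_oneSidedJunta_shift_of hE ht hε S hS T hT0 hT

/-! ## §3 Rank-one corollaries: row-junta, column-junta and mixed factorisations -/

/-- **Mixed one-sided rank-one factorisations are impossible.** No identity
`viol_F(x[w]) - ε = ∑_l u_l(x) v_l(w)` with `u_l, v_l ≥ 0` in which every term has a junta SIDE OF ITS
CHOICE: `u_l` depends only on the blocks `x i`, `i ∈ S l`, or `v_l` only on `w i`, `i ∈ S l`
(`#(S l) ≤ d`; the other factor is arbitrary). -/
theorem no_mixedJunta_shift_of {m d t : ℕ} {F : Finset (Pool m)} (hE : HasPerfectPseudoExp d F)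
    (ht : 2 ≤ t) {ε : ℝ} (hε : 0 < ε) {L : Type} [Fintype L] (S : L → Finset (Fin m))
    (hS : ∀ l, (S l).card ≤ d)
    (u : L → (Fin m → Fin t → ZMod 2) → ℝ) (v : L → (Fin m → Fin t) → ℝ)
    (hu0 : ∀ l x, 0 ≤ u l x) (hv0 : ∀ l w, 0 ≤ v l w)
    (huv : ∀ l, (∀ x x' : Fin m → Fin t → ZMod 2, (∀ i ∈ S l, x i = x' i) → u l x = u l x') ∨
                (∀ w w' : Fin m → Fin t, (∀ i ∈ S l, w i = w' i) → v l w = v l w')) :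
    ¬ ∀ (x : Fin m → Fin t → ZMod 2) (w : Fin m → Fin t),
        (viol F (fun i => x i (w i)) : ℝ) - ε = ∑ l, u l x * v l w := by
  refine no_oneSidedJunta_shift_of hE ht hε S hS (fun l x w => u l x * v l w)
    (fun l x w => mul_nonneg (hu0 l x) (hv0 l w)) fun l => ?_
  rcases huv l with hrow | hcol
  · exact Or.inl fun w x x' h => by rw [hrow x x' h]
  · exact Or.inr fun x w w' h => by rw [hcol w w' h]

/-- **Row-junta factorisations are impossible** (column factors arbitrary): no identity
`viol_F(x[w]) - ε = ∑_l u_l(x) v_l(w)`, `u_l, v_l ≥ 0`, with every `u_l` depending only on the blocks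
`x i`, `i ∈ S l`, `#(S l) ≤ d`. (The landed `no_blockJunta_shift_of` is the special case in which the
`v_l` are block-juntas on the same blocks as well.) -/
theorem no_rowJunta_shift_of {m d t : ℕ} {F : Finset (Pool m)} (hE : HasPerfectPseudoExp d F)
    (ht : 2 ≤ t) {ε : ℝ} (hε : 0 < ε) {L : Type} [Fintype L] (S : L → Finset (Fin m))
    (hS : ∀ l, (S l).card ≤ d)
    (u : L → (Fin m → Fin t → ZMod 2) → ℝ) (v : L → (Fin m → Fin t) → ℝ)
    (hu0 : ∀ l x, 0 ≤ u l x) (hv0 : ∀ l w, 0 ≤ v l w)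
    (hu : ∀ l (x x' : Fin m → Fin t → ZMod 2), (∀ i ∈ S l, x i = x' i) → u l x = u l x') :
    ¬ ∀ (x : Fin m → Fin t → ZMod 2) (w : Fin m → Fin t),
        (viol F (fun i => x i (w i)) : ℝ) - ε = ∑ l, u l x * v l w :=
  no_mixedJunta_shift_of hE ht hε S hS u v hu0 hv0 fun l => Or.inl (hu l)

/-- **Column-junta factorisations are impossible** (row factors arbitrary): no identity
`viol_F(x[w]) - ε = ∑_l u_l(x) v_l(w)`, `u_l, v_l ≥ 0`, with every `v_l` depending only on the pointers
`w i`, `i ∈ S l`, `#(S l) ≤ d` — e.g. the column dictionary `1[w_S = π]` of the cheap factorisation of the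
UNshifted lift can never be re-weighted, row by row, into a factorisation of a positive shift. -/
theorem no_colJunta_shift_of {m d t : ℕ} {F : Finset (Pool m)} (hE : HasPerfectPseudoExp d F)
    (ht : 2 ≤ t) {ε : ℝ} (hε : 0 < ε) {L : Type} [Fintype L] (S : L → Finset (Fin m))
    (hS : ∀ l, (S l).card ≤ d)
    (u : L → (Fin m → Fin t → ZMod 2) → ℝ) (v : L → (Fin m → Fin t) → ℝ)
    (hu0 : ∀ l x, 0 ≤ u l x) (hv0 : ∀ l w, 0 ≤ v l w)
    (hv : ∀ l (w w' : Fin m → Fin t), (∀ i ∈ S l, w i = w' i) → v l w = v l w') :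
    ¬ ∀ (x : Fin m → Fin t → ZMod 2) (w : Fin m → Fin t),
        (viol F (fun i => x i (w i)) : ℝ) - ε = ∑ l, u l x * v l w :=
  no_mixedJunta_shift_of hE ht hε S hS u v hu0 hv0 fun l => Or.inr (hv l)

/-! ## §4 Cone factorisations with junta columns -/

/-- **No cone factorisation of a positive shift with junta columns.** In the format of `HasConeFact`
(`viol_F(x[w]) - ε = tr(H_x Y_w) + ∑_l U_{x,l} V_{l,w}`, `H_x, Y_w ⪰ 0`, `U, V ≥ 0`): if the PSD column
factor `Y_w` depends only on the pointers `w i`, `i ∈ S₀` (`#S₀ ≤ d`) and every LP column factor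
`V_{l,·}` only on `w i`, `i ∈ S l` (`#(S l) ≤ d`), the identity is impossible — for every `q`, `r`, every
`t ≥ 2` and every `ε > 0`, with `H` and `U` arbitrary. -/
theorem no_colJunta_coneFact_of {m d t q r : ℕ} {F : Finset (Pool m)} (hE : HasPerfectPseudoExp d F)
    (ht : 2 ≤ t) {ε : ℝ} (hε : 0 < ε)
    (H : (Fin m → Fin t → ZMod 2) → Matrix (Fin q) (Fin q) ℝ)
    (Y : (Fin m → Fin t) → Matrix (Fin q) (Fin q) ℝ)
    (U : (Fin m → Fin t → ZMod 2) → Fin r → ℝ) (V : Fin r → (Fin m → Fin t) → ℝ)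
    (hH : ∀ x, (H x).PosSemidef) (hY : ∀ w, (Y w).PosSemidef)
    (hU : ∀ x l, 0 ≤ U x l) (hV : ∀ l w, 0 ≤ V l w)
    (S₀ : Finset (Fin m)) (hS₀ : S₀.card ≤ d)
    (hYj : ∀ w w' : Fin m → Fin t, (∀ i ∈ S₀, w i = w' i) → Y w = Y w')
    (S : Fin r → Finset (Fin m)) (hS : ∀ l, (S l).card ≤ d)
    (hVj : ∀ l (w w' : Fin m → Fin t), (∀ i ∈ S l, w i = w' i) → V l w = V l w') :
    ¬ ∀ (x : Fin m → Fin t → ZMod 2) (w : Fin m → Fin t),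
        (viol F (fun i => x i (w i)) : ℝ) - ε = (H x * Y w).trace + ∑ l, U x l * V l w := by
  intro hfact
  -- one PSD term (index `none`) and `r` LP terms (indices `some l`)
  refine no_oneSidedJunta_shift_of hE ht hε (L := Option (Fin r))
    (fun o => o.elim S₀ S) (fun o => ?_)
    (fun o x w => o.elim ((H x * Y w).trace) (fun l => U x l * V l w)) (fun o x w => ?_) (fun o => ?_) ?_
  · cases o with
    | none => exact hS₀
    | some l => exact hS l
  · cases o with
    | none => exact trace_mul_nonneg_of_posSemidef (hH x) (hY w)
    | some l => exact mul_nonneg (hU x l) (hV l w)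
  · cases o with
    | none => exact Or.inr fun x w w' h => by simp only [Option.elim, hYj w w' h]
    | some l => exact Or.inr fun x w w' h => by simp only [Option.elim, hVj l w w' h]
  · intro x w
    rw [hfact x w, Fintype.sum_option]
    simp only [Option.elim]

end

end Summit.PneNP.PneNP.Theorems.XorDoor
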